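import Summits.HodgeConjecture.CorCM.IrreducibleOddWeightsDichotomyCMFields
import HarnessLib

/-!
# The capacity dichotomy is sharp: (SC) ⟺ the CM field carries `[K:ℚ]/2` CM types forming a nondegenerate family

COR-CM (cell `pub-hodgecm2`, binder seat `b16` gen 55, count-neutral claim IRR-ODD, file F9 — sequel of F5b
`CorCM/IrreducibleOddWeightsDichotomyCMFields` and of seat gen 54 `StabiliserOrbitSelfConjugateCMFields`; theorems only,
no definition, no named fact, no `sorry`).  NEW as stated, hence under `Summits/`.  HONEST FRAMING: statements about
families of CM types of ONE CM field; `HC_CM` is neither used nor asserted.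

F5b proved: if (SC) fails for the CM field `K` of degree `2n`, every nondegenerate family of CM types of `K` has at most
`n/2` members.  Here the converse half: under (SC) the capacity `n` (Kubota's bound, tree
`card_le_finrank_div_two_of_isNondegenerateFamily`) is ATTAINED — flip a CM type `Φ₀` at each of its members except
one: the `n` types `Φ₀` and `Φ₀ △ {x, x̄}` (`x ∈ Φ₀ ∖ {x₀}`) have linearly independent type vectors (`u₀` and
`u₀ − 2(δ_x − δ_x̄)`), hence form a nondegenerate family by gen 54's criterion.  So

> **`stabConj_iff_exists_isNondegenerateFamily`** — (SC) ⟺ there is a nondegenerate family of `[K:ℚ]/2` CM types of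
> `K` (indexed by the members of any CM type `Φ₀`); with F5b: ⟺ some nondegenerate family has more than `[K:ℚ]/4`
> members.  THE CAPACITY OF A CM FIELD IS `n` OR AT MOST `n/2`, AND IT IS `n` EXACTLY FOR THE (SC) FIELDS.

* `exists_flip` (the flipped CM type `Φ₀ △ {x, x̄}` as a `CMType`), **`exists_isNondegenerateFamily_of_stabConj`**
  (under (SC): a nondegenerate family indexed by `Φ₀`), **`stabConj_iff_exists_isNondegenerateFamily`**.

## References

* [Gordon1999HodgeAVSurvey] B. B. Gordon, *A survey of the Hodge conjecture for abelian varieties*, 7.5–7.7.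
* [Wielandt1964] H. Wielandt, *Finite Permutation Groups* (1964), Thm. 28.4.
* [Shimura1998] G. Shimura, *Abelian Varieties with Complex Multiplication and Modular Functions*, §8.2.
-/

set_option autoImplicit false

noncomputable section

open CategoryTheory CategoryTheory.Limits NumberField

namespace Summit.HodgeConjecture.CorCM

open Literature.NumberTheory.ComplexMultiplication
open Literature.AlgebraicGeometry.Motives (AbelianVariety CMType)
open Literature.AlgebraicGeometry.HodgeTheory
open Literature.AlgebraicGeometry.Pohlmann1968
open GenericCMField
open scoped Classical

variable {K : Type} [Field K] [NumberField K] [IsCMField K]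

/-! ## §1 Flipping a CM type at one conjugate pair -/

omit [NumberField K] [IsCMField K] in
/-- **The flipped CM type `Φ₀ △ {x, x̄}`** (`x ∈ Φ₀`): remove `x`, add `x̄`. [cite: Shimura1998, §8.2] -/
theorem exists_flip (Φ₀ : CMType K) {x : K →+* ℂ} (hx : x ∈ Φ₀.1) :
    ∃ Ψ : CMType K, ∀ y : K →+* ℂ, y ∈ Ψ.1 ↔ (y ∈ Φ₀.1 ∧ y ≠ x) ∨ y = ComplexEmbedding.conjugate x := by
  have hxc : ComplexEmbedding.conjugate x ∉ Φ₀.1 := (Φ₀.2 x).1 hx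
  have hinv : ∀ y : K →+* ℂ, ComplexEmbedding.conjugate (ComplexEmbedding.conjugate y) = y :=
    fun y => ComplexEmbedding.involutive_conjugate K y
  have hxne : x ≠ ComplexEmbedding.conjugate x := fun h => hxc (by rw [h] at hx; exact hx)
  refine ⟨⟨{y | (y ∈ Φ₀.1 ∧ y ≠ x) ∨ y = ComplexEmbedding.conjugate x}, fun φ => ?_⟩, fun y => Iff.rfl⟩
  simp only [Set.mem_setOf_eq]
  by_cases h1 : φ = x
  · rw [h1]
    constructor
    · rintro (⟨-, h⟩ | h)
      · exact (h rfl).elim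
      · exact (hxne h).elim
    · intro h
      exact (h (Or.inr rfl)).elim
  by_cases h2 : φ = ComplexEmbedding.conjugate x
  · rw [h2, hinv]
    constructor
    · rintro - (⟨-, h⟩ | h)
      · exact h rfl
      · exact hxne h
    · intro _
      exact Or.inr rfl
  · have h3 : ComplexEmbedding.conjugate φ ≠ x := fun h => h2 (by rw [← h, hinv])
    have h4 : ComplexEmbedding.conjugate φ ≠ ComplexEmbedding.conjugate x := fun h =>
      h1 ((ComplexEmbedding.involutive_conjugate K).injective h)
    constructor
    · rintro (⟨hmem, -⟩ | h)
      · rintro (⟨hc, -⟩ | hc)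
        · exact (Φ₀.2 φ).1 hmem hc
        · exact h4 hc
      · exact (h2 h).elim
    · intro hc
      exact Or.inl ⟨(Φ₀.2 φ).2 fun hcm => hc (Or.inl ⟨hcm, h3⟩), h1⟩

/-! ## §2 Under (SC) the capacity `[K:ℚ]/2` is attained -/

omit [IsCMField K] in
/-- A CM type is nonempty (`2|Φ₀| = [K:ℚ] ≥ 1`). [folklore] -/
theorem cmType_nonempty (Φ₀ : CMType K) : Φ₀.1.Nonempty := by
  by_contra h
  rw [Set.not_nonempty_iff_eq_empty] at h
  have h2 := Literature.AlgebraicGeometry.Motives.HodgeStructure.two_mul_ncard_cmType_eq_finrank Φ₀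
  rw [h, Set.ncard_empty, mul_zero] at h2
  exact (Module.finrank_pos (R := ℚ) (M := K)).ne' h2.symm

omit [IsCMField K] in
/-- `|Φ₀| = [K:ℚ]/2` as a `Fintype.card` of the subtype. [folklore] -/
theorem card_coe_cmType (Φ₀ : CMType K) : Fintype.card Φ₀.1 = Module.finrank ℚ K / 2 := by
  have h2 := Literature.AlgebraicGeometry.Motives.HodgeStructure.two_mul_ncard_cmType_eq_finrank Φ₀
  have h3 : Φ₀.1.ncard = Fintype.card Φ₀.1 := by rw [Set.ncard_eq_toFinset_card', Set.toFinset_card]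
  omega

/-- **UNDER (SC) THE CAPACITY `n = [K:ℚ]/2` IS ATTAINED**: for every CM type `Φ₀` there is a nondegenerate family of
CM types of `K` indexed by the `n` members of `Φ₀` — `Φ₀` itself at a base member `x₀` and the flips `Φ₀ △ {x, x̄}`
at the others (type vectors `u₀`, `u₀ − 2(δ_x − δ_x̄)`: linearly independent).
[cite: Gordon1999HodgeAVSurvey, 7.5–7.7] [cite: Wielandt1964, Thm. 28.4] -/
theorem exists_isNondegenerateFamily_of_stabConj
    (hSC : ∀ x₀ x : K →+* ℂ, x ≠ x₀ → x ≠ (starRingAut : ℂ ≃+* ℂ) • x₀ →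
      ∃ σ : ℂ ≃+* ℂ, σ • x₀ = x₀ ∧ σ • x = (starRingAut : ℂ ≃+* ℂ) • x)
    (Φ₀ : CMType K) :
    ∃ Ψ : Φ₀.1 → CMType K, CMAlgebra.IsNondegenerateFamily (K := fun _ : Φ₀.1 => K) Ψ := by
  obtain ⟨x₀, hx₀⟩ := cmType_nonempty Φ₀
  haveI : Nonempty Φ₀.1 := ⟨⟨x₀, hx₀⟩⟩
  -- the flips
  choose F hF using fun x : Φ₀.1 => exists_flip Φ₀ x.2
  let Ψ : Φ₀.1 → CMType K := fun x => if (x : K →+* ℂ) = x₀ then Φ₀ else F x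
  refine ⟨Ψ, ?_⟩
  rw [isNondegenerateFamily_iff_linearIndependent_of_stabConj hSC Ψ]
  -- values of the type vectors at members of `Φ₀`
  have hval : ∀ x y : Φ₀.1, antiVec (Ψ x).1 (1 : ℂ ≃+* ℂ) (y : K →+* ℂ) =
      if (x : K →+* ℂ) ≠ x₀ ∧ x = y then -1 else 1 := by
    intro x y
    have hyc : (y : K →+* ℂ) ≠ ComplexEmbedding.conjugate (x : K →+* ℂ) := fun h =>
      (Φ₀.2 (x : K →+* ℂ)).1 x.2 (h ▸ y.2)
    by_cases hx : (x : K →+* ℂ) = x₀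
    · have hΨ : Ψ x = Φ₀ := if_pos hx
      rw [hΨ, if_neg (fun h => h.1 hx), antiVec_one_apply_eq_one_iff]
      exact y.2
    · have hΨ : Ψ x = F x := if_neg hx
      rw [hΨ]
      by_cases hxy : x = y
      · subst hxy
        rw [if_pos ⟨hx, rfl⟩]
        rcases antiVec_one_apply_eq_or (F x) (x : K →+* ℂ) with h | h
        · exact absurd ((hF x _).1 ((antiVec_one_apply_eq_one_iff (F x) _).1 h))
            (by rintro (⟨-, hne⟩ | hc) <;> [exact hne rfl; exact hyc hc])
        · exact h
      · rw [if_neg (fun h => hxy h.2), antiVec_one_apply_eq_one_iff, hF]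
        exact Or.inl ⟨y.2, fun h => hxy (Subtype.ext h.symm)⟩
  -- linear independence: evaluate a relation at `x₀` and at each member
  rw [Fintype.linearIndependent_iff]
  intro c hc
  have heval : ∀ y : Φ₀.1, ∑ x, c x * antiVec (Ψ x).1 (1 : ℂ ≃+* ℂ) (y : K →+* ℂ) = 0 := fun y => by
    have h := congrFun hc (y : K →+* ℂ)
    simpa only [Finset.sum_apply, Pi.smul_apply, smul_eq_mul, Pi.zero_apply] using h
  have hsum : ∀ y : Φ₀.1, ∑ x, c x * antiVec (Ψ x).1 (1 : ℂ ≃+* ℂ) (y : K →+* ℂ) =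
      (∑ x, c x) - 2 * (if (y : K →+* ℂ) ≠ x₀ then c y else 0) := by
    intro y
    have h1 : ∀ x, c x * antiVec (Ψ x).1 (1 : ℂ ≃+* ℂ) (y : K →+* ℂ) =
        c x - 2 * (if (x : K →+* ℂ) ≠ x₀ ∧ x = y then c x else 0) := fun x => by
      rw [hval]
      split_ifs <;> ring
    rw [Finset.sum_congr rfl fun x _ => h1 x, Finset.sum_sub_distrib, ← Finset.mul_sum]
    congr 2
    by_cases hy : (y : K →+* ℂ) ≠ x₀
    · rw [if_pos hy]
      have h2 : ∀ x : Φ₀.1, (if (x : K →+* ℂ) ≠ x₀ ∧ x = y then c x else 0) = if x = y then c x else 0 :=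
        fun x => by
          by_cases hxy : x = y
          · rw [if_pos ⟨hxy ▸ hy, hxy⟩, if_pos hxy]
          · rw [if_neg (fun h => hxy h.2), if_neg hxy]
      rw [Finset.sum_congr rfl fun x _ => h2 x, Finset.sum_ite_eq' Finset.univ y, if_pos (Finset.mem_univ y)]
    · rw [if_neg hy]
      refine Finset.sum_eq_zero fun x _ => ?_
      rw [if_neg]
      rintro ⟨hx, hxy⟩
      exact hy (hxy ▸ hx)
  have htot : ∑ x, c x = 0 := by
    have h := heval ⟨x₀, hx₀⟩
    rw [hsum] at h
    simpa using h
  intro y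
  by_cases hy : (y : K →+* ℂ) = x₀
  · -- `c y = Σ c − Σ_{x ≠ y} c x`, all other coefficients vanish
    have hothers : ∀ x : Φ₀.1, (x : K →+* ℂ) ≠ x₀ → c x = 0 := fun x hx => by
      have h := heval x
      rw [hsum, htot, if_pos hx] at h
      linarith
    have h1 : ∑ x, c x = c y := by
      rw [← Finset.sum_erase_add _ _ (Finset.mem_univ y)]
      rw [Finset.sum_eq_zero fun x hx => hothers x fun h => ?_, zero_add]
      exact (Finset.mem_erase.1 hx).1 (Subtype.ext (h.trans hy.symm))
    rw [← h1, htot]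
  · have h := heval y
    rw [hsum, htot, if_pos hy] at h
    linarith

/-- **(SC) ⟺ THE CM FIELD CARRIES `[K:ℚ]/2` CM TYPES FORMING A NONDEGENERATE FAMILY** (indexed by the members of any CM
type `Φ₀`): ⟹ by the flips above, ⟸ by F5b (off (SC) a nondegenerate family has at most `[K:ℚ]/4 < [K:ℚ]/2`
members).  The capacity of a CM field is `n` exactly for the (SC) fields and at most `n/2` otherwise.
[cite: Gordon1999HodgeAVSurvey, 7.5–7.7] [cite: Wielandt1964, Thm. 28.4] -/
theorem stabConj_iff_exists_isNondegenerateFamily (Φ₀ : CMType K) :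
    (∀ x₀ x : K →+* ℂ, x ≠ x₀ → x ≠ (starRingAut : ℂ ≃+* ℂ) • x₀ →
      ∃ σ : ℂ ≃+* ℂ, σ • x₀ = x₀ ∧ σ • x = (starRingAut : ℂ ≃+* ℂ) • x) ↔
    ∃ Ψ : Φ₀.1 → CMType K, CMAlgebra.IsNondegenerateFamily (K := fun _ : Φ₀.1 => K) Ψ := by
  refine ⟨fun hSC => exists_isNondegenerateFamily_of_stabConj hSC Φ₀, fun ⟨Ψ, hΨ⟩ x₀ x hx hx' => ?_⟩
  obtain ⟨y₀, hy₀⟩ := cmType_nonempty Φ₀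
  haveI : Nonempty Φ₀.1 := ⟨⟨y₀, hy₀⟩⟩
  refine stabConj_of_isNondegenerateFamily hΨ ?_ x₀ x hx hx'
  rw [card_coe_cmType]
  have h := Module.finrank_pos (R := ℚ) (M := K)
  have h2 := Literature.AlgebraicGeometry.Motives.HodgeStructure.two_mul_ncard_cmType_eq_finrank Φ₀
  omega

end Summit.HodgeConjecture.CorCM

end
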